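import Mathlib
import Summits.PneNP.PneNP.Theorems.Nc03AvoidResidualCoreReductionSolveKit
import Summits.PneNP.PneNP.Theorems.Nc03AvoidResidualCoreReductionLinA
import Literature.Computability.Complexity.GaussRankFP

/-!
# Route Nc03AvoidResidualCore, item `ResidualCoreReduction` — the solver, VI: the span test

Helper file for `stmt-PneNP-20227` (sequel of `…ReductionSolveKit`; cell pnp-ideate). The rank-based
class solvers (`3, 7, 8, 9, 10, 11`) test membership of an `𝔽₂`-vector in the span of a list of
vectors; all vectors in question are sums of unit vectors of variables. Here:

* `rowVec N L` — the list of the `N` coordinates of `Σ_{v ∈ L} e_v` over `𝔽₂` (program form) and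
  `vecL N L : Vec N` (function form), with `vecL N [a, b] = ind a + ind b` etc.;
* `inSpan N rows v` — the test `rank (rows, v) = rank rows` with the tree's list Gaussian
  elimination `GaussRank.lrank`, and **`inSpan_iff`**: it holds iff `vecL N v` lies in the span of
  the `vecL N r`, `r ∈ rows` (via `lrank_eq_finrank_span`);
* `codeFP_rowVec`, `codeFP_inSpan` — both are polynomial time (`GaussRank.codeFP_lrank`).
-/

set_option linter.dupNamespace false -- `Summit.PneNP.PneNP.…`: summit = sub-problem name (D-0017 single-conjunct layout)

namespace Summit.PneNP.PneNP.Theorems.Nc03Reduction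

open Literature.Computability.Complexity CodeFP GaussRank

/-! ## Vectors of index lists -/

/-- The coordinate list of `Σ_{v ∈ L} e_v ∈ 𝔽₂^N`. -/
def rowVec (N : ℕ) (L : List ℕ) : List (ZMod 2) := (List.range N).map fun k => ((L.count k : ℕ) : ZMod 2)

/-- The vector `Σ_{v ∈ L} e_v ∈ 𝔽₂^N`. -/
def vecL (N : ℕ) (L : List ℕ) : Vec N := fun k => ((L.count k.val : ℕ) : ZMod 2)

/-- The coordinate list has length `N`. -/
@[simp] theorem length_rowVec (N : ℕ) (L : List ℕ) : (rowVec N L).length = N := by simp [rowVec]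

/-- Reading the coordinate list. -/
theorem rowVec_getD {N : ℕ} (L : List ℕ) (k : Fin N) : (rowVec N L).getD k.val 0 = vecL N L k := by
  unfold rowVec vecL
  rw [List.getD_eq_getElem?_getD, List.getElem?_map, List.getElem?_range k.isLt]
  rfl

/-- The coordinate list as a function is the vector. -/
theorem rowVec_fun {N : ℕ} (L : List ℕ) : (fun k : Fin N => (rowVec N L).getD k.val 0) = vecL N L :=
  funext (rowVec_getD L)

/-- The empty index list gives the zero vector. -/
theorem vecL_nil {N : ℕ} : vecL N [] = 0 := by
  funext k; simp [vecL]

/-- Consing an index adds its unit vector. -/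
theorem vecL_cons {N : ℕ} (a : Fin N) (L : List ℕ) : vecL N (a.val :: L) = ind a + vecL N L := by
  funext k
  simp only [vecL, ind, Pi.add_apply, List.count_cons, beq_iff_eq, Nat.cast_add, Nat.cast_ite,
    Nat.cast_one, Nat.cast_zero]
  by_cases h : k = a
  · subst h; simp [add_comm]
  · have : a.val ≠ k.val := fun e => h (Fin.ext e.symm)
    simp [h, this]

/-- Two unit vectors. -/
theorem vecL_pair {N : ℕ} (a b : Fin N) : vecL N [a.val, b.val] = ind a + ind b := by
  rw [vecL_cons, vecL_cons, vecL_nil, add_zero]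

/-- Three unit vectors. -/
theorem vecL_trip {N : ℕ} (a b c : Fin N) : vecL N [a.val, b.val, c.val] = ind a + ind b + ind c := by
  rw [vecL_cons, vecL_cons, vecL_cons, vecL_nil, add_zero, add_assoc]

/-! ## The span test -/

/-- The span test: appending `v` to `rows` does not raise the rank. -/
def inSpan (N : ℕ) (rows : List (List ℕ)) (v : List ℕ) : Bool :=
  decide (lrank N (rows.map (rowVec N) ++ [rowVec N v]) = lrank N (rows.map (rowVec N)))

/-- The vectors indexed by the rows of a list of coordinate lists are the vectors of its members. -/
theorem range_rows_eq {N : ℕ} (R : List (List (ZMod 2))) :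
    Set.range (fun i : Fin R.length => fun k : Fin N => (R.getD i.val []).getD k.val 0) =
      {u | ∃ r ∈ R, u = fun k : Fin N => r.getD k.val 0} := by
  ext u
  constructor
  · rintro ⟨i, rfl⟩
    refine ⟨R.getD i.val [], ?_, rfl⟩
    rw [List.getD_eq_getElem?_getD, List.getElem?_eq_getElem i.isLt]
    exact List.getElem_mem _
  · rintro ⟨r, hr, rfl⟩
    obtain ⟨i, hi, rfl⟩ := List.getElem_of_mem hr
    refine ⟨⟨i, hi⟩, ?_⟩
    simp only
    rw [List.getD_eq_getElem?_getD, List.getElem?_eq_getElem hi, Option.getD_some]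

/-- The vectors of the members of `rows.map (rowVec N)`. -/
theorem vecs_of_map {N : ℕ} (rows : List (List ℕ)) :
    {u | ∃ r ∈ rows.map (rowVec N), u = fun k : Fin N => r.getD k.val 0} = vecL N '' {r | r ∈ rows} := by
  ext u
  simp only [Set.mem_setOf_eq, List.mem_map, Set.mem_image]
  constructor
  · rintro ⟨_, ⟨r, hr, rfl⟩, rfl⟩; exact ⟨r, hr, (rowVec_fun r).symm⟩
  · rintro ⟨r, hr, rfl⟩; exact ⟨rowVec N r, ⟨r, hr, rfl⟩, (rowVec_fun r).symm⟩

/-- In a finite-dimensional space, a vector lies in the span of a set iff adjoining it does not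
raise the dimension of the span. -/
theorem mem_span_iff_finrank_insert {N : ℕ} (S : Set (Vec N)) (x : Vec N) :
    x ∈ Submodule.span (ZMod 2) S ↔
      Module.finrank (ZMod 2) (Submodule.span (ZMod 2) (insert x S)) =
        Module.finrank (ZMod 2) (Submodule.span (ZMod 2) S) := by
  constructor
  · intro hx; rw [Submodule.span_insert_eq_span hx]
  · intro h
    have hle : Submodule.span (ZMod 2) S ≤ Submodule.span (ZMod 2) (insert x S) :=
      Submodule.span_mono (Set.subset_insert x S)
    have heq := Submodule.eq_of_le_of_finrank_eq hle h.symm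
    rw [heq]
    exact Submodule.subset_span (Set.mem_insert x S)

/-- **The span test is correct**: `inSpan N rows v` iff `Σ_{w ∈ v} e_w` lies in the span of the
`Σ_{w ∈ r} e_w`, `r ∈ rows`. -/
theorem inSpan_iff {N : ℕ} (rows : List (List ℕ)) (v : List ℕ) :
    inSpan N rows v = true ↔ vecL N v ∈ Submodule.span (ZMod 2) (vecL N '' {r | r ∈ rows}) := by
  unfold inSpan
  rw [decide_eq_true_eq]
  have hN1 : ∀ r ∈ rows.map (rowVec N), r.length = N := by
    intro r hr; obtain ⟨r', -, rfl⟩ := List.mem_map.1 hr; exact length_rowVec N r'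
  have hN2 : ∀ r ∈ rows.map (rowVec N) ++ [rowVec N v], r.length = N := by
    intro r hr
    rcases List.mem_append.1 hr with hr | hr
    · exact hN1 r hr
    · rw [List.mem_singleton.1 hr]; exact length_rowVec N v
  rw [lrank_eq_finrank_span _ hN2, lrank_eq_finrank_span _ hN1, range_rows_eq, range_rows_eq,
    vecs_of_map]
  have hins : {u | ∃ r ∈ rows.map (rowVec N) ++ [rowVec N v], u = fun k : Fin N => r.getD k.val 0} =
      insert (vecL N v) (vecL N '' {r | r ∈ rows}) := by
    rw [← vecs_of_map]
    ext u
    simp only [Set.mem_setOf_eq, List.mem_append, List.mem_singleton, Set.mem_insert_iff]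
    constructor
    · rintro ⟨r, hr | hr, rfl⟩
      · exact Or.inr ⟨r, hr, rfl⟩
      · exact Or.inl (by rw [hr, rowVec_fun])
    · rintro (rfl | ⟨r, hr, rfl⟩)
      · exact ⟨rowVec N v, Or.inr rfl, (rowVec_fun v).symm⟩
      · exact ⟨r, Or.inl hr, rfl⟩
  rw [hins]
  exact (mem_span_iff_finrank_insert _ _).symm

/-! ## Polynomial time -/

/-- The coordinate list is polynomial time (in `N` unary and the index list). -/
theorem codeFP_rowVec : CodeFP (pairE unE (rawE natE)) (rowE 2) (fun p => rowVec p.1 p.2) := by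
  have hg : CodeFP (pairE (rawE natE) natE) (zmodE 2) (fun q => ((q.1.count q.2 : ℕ) : ZMod 2)) :=
    (zmodOfNat (p := 2)).comp (rawCountNat.comp ((snd _ _).pair (fst _ _)))
  exact ((map hg).comp ((snd _ _).pair (urange.comp (fst _ _)))).congr fun _ => rfl

/-- **The span test is polynomial time.** -/
theorem codeFP_inSpan :
    CodeFP (pairE unE (pairE (rawE (rawE natE)) (rawE natE))) bitE (fun p => inSpan p.1 p.2.1 p.2.2) := by
  have hN : CodeFP (pairE unE (pairE (rawE (rawE natE)) (rawE natE))) unE (fun p => p.1) := fst _ _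
  have hrows : CodeFP (pairE unE (pairE (rawE (rawE natE)) (rawE natE))) (rawE (rowE 2))
      (fun p => p.2.1.map (rowVec p.1)) :=
    ((map (σ := ℕ) (eσ := unE) (g := fun q => rowVec q.1 q.2) codeFP_rowVec).comp
      (hN.pair (snd _ _).fst')).congr fun _ => rfl
  have hv : CodeFP (pairE unE (pairE (rawE (rawE natE)) (rawE natE))) (rowE 2) (fun p => rowVec p.1 p.2.2) :=
    codeFP_rowVec.comp (hN.pair (snd _ _).snd')
  have hext : CodeFP (pairE unE (pairE (rawE (rawE natE)) (rawE natE))) (rawE (rowE 2))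
      (fun p => p.2.1.map (rowVec p.1) ++ [rowVec p.1 p.2.2]) :=
    (rawAppend (rowE 2)).comp (hrows.pair ((rawSingleton (rowE 2)).comp hv))
  have h1 := (codeFP_lrank (p := 2)).comp (hN.pair hext)
  have h2 := (codeFP_lrank (p := 2)).comp (hN.pair hrows)
  exact (natEq.comp (h1.pair h2)).congr fun _ => rfl

end Summit.PneNP.PneNP.Theorems.Nc03Reduction
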